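import Mathlib
import Literature.AlgebraicGeometry.Resolution.CobordantGame
import Summits.ResolutionOfSingularities.ResolutionOfSingularities.Theorems.WeightedInvariantLocalWeightedDropCharTwoDoublePointMonic
import Summits.ResolutionOfSingularities.ResolutionOfSingularities.Theorems.WeightedInvariantLocalWeightedDropTerminalDoublePoints
import Summits.ResolutionOfSingularities.ResolutionOfSingularities.Theorems.WeightedInvariantLocalWeightedDropSeparableTerminalDoublePoints
import Summits.ResolutionOfSingularities.ResolutionOfSingularities.Theorems.WeightedInvariantLocalWeightedDropSeparablePureReduction
import Summits.ResolutionOfSingularities.ResolutionOfSingularities.Theorems.WeightedInvariantLocalWeightedDropMonicDoublePointLiftReduced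
import Summits.ResolutionOfSingularities.ResolutionOfSingularities.Theorems.WeightedInvariantLocalWeightedDropMonicDescentDefs

/-!
# `WeightedInvariant.LocalWeightedDrop`, line `hasse-ridge-face-selection`: S2 (char-2 surface double points) FROM EITHER KEY —
# the class keys S2iM ∧ S2sP, or the lead's key `stub_monicDoublePointDescends` — ORDER XS of CHAIN v4.1 (iv) + the by-name corollaries

Crux item stmt-ResolutionOfSingularities-8899 `LocalWeightedDrop` (route `ResolutionOfSingularities/WeightedInvariant`), serving the
door `WeightedConstruction` stmt-ResolutionOfSingularities-0571 / `HypersurfaceCentreConstruction` stmt-ResolutionOfSingularities-19897.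
[OURS · L1 W4.3, chain w43, stub worker 5 (seat res-D-pv-056); BOOKKEEPING ONLY — no new mathematics: every implication below is the
derivation written in plan-1's registered skeleton v28 (b8b73808bd522080), now importable from the tree so that the by-name closing files
of the registered stubs are three-liners the moment a key lands.]

Registered stubs of v28 touched here (statements VERBATIM as hypotheses / conclusions):
* S2iM `stub_charTwoInseparableReductionWon`, S2sP `stub_charTwoSeparablePureWon` (class keys of the S2 piece);
* `stub_monicDoublePointDescends` (the lead's key: every reduced position of the descent game `MonicDescent.Descends`).

Contents:
* `charTwoDoublePointSurfaceWon_of_classKeys : (S2iM) → (S2sP) → S2` — the twin of stub worker 1's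
  `wildUnaryConeSurfaceWon_of_classKeys` (p487612): S2iT = `stub_charTwoInseparableTerminalWon` (p479529) and
  S2sT = `stub_charTwoSeparableTerminalWon` (p481821) are landed theorems, S2sM ⇐ S2sP is `charTwoSeparableReduction_of_pureWon`
  (p484361), and the monic interface is `charTwoDoublePointSurfaceWon_of_monicForms` (p468075).
* `monicDoublePointsWon_of_descends : (Descends key) → all char-2 monic double points are won` — `formalStep_of_descends` (p485496) ∘
  `charTwoDoublePointSurfaceWon_of_reducedFormalRank` (p482941) ∘ `monicFormsWon_of_charTwoDoublePointSurfaceWon` (p468075).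
* `charTwoDoublePointSurfaceWon_of_descends`, `charTwoInseparableReduction_of_descends` (S2iM verbatim),
  `charTwoSeparablePure_of_descends` (S2sP verbatim), `charTwoSeparableReduction_of_descends` (S2sM verbatim) — the by-name corollaries:
  once `stub_monicDoublePointDescends` is a tree theorem, `stub_charTwoSeparablePureWon := charTwoSeparablePure_of_descends
  stub_monicDoublePointDescends` etc. close the class stubs of the S2 piece BY NAME.
AI-written; gate-accepted means sorry-free with standard axioms, not refereed.
-/

set_option linter.dupNamespace false -- mandated namespace of this single-conjunct summit

namespace Summit.ResolutionOfSingularities.ResolutionOfSingularities.Theorems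

open Literature.AlgebraicGeometry.Resolution
open Literature.AlgebraicGeometry.Resolution.CobordantGame

/-- `ord (x₀^a x₁^b) = a + b > 1` when `a + b ≥ 2` (the S2sP monomial coefficient is a legitimate `A₁`). -/
theorem one_lt_order_X_pow_mul_X_pow {k : Type} [Field k] {a b : ℕ} (hab : 2 ≤ a + b) :
    (1 : ℕ∞) < (MvPowerSeries.X (0 : Fin 2) ^ a * MvPowerSeries.X (1 : Fin 2) ^ b : MvPowerSeries (Fin 2) k).order := by
  have hX : ∀ (i : Fin 2) (n : ℕ), ((MvPowerSeries.X i : MvPowerSeries (Fin 2) k) ^ n).order = n := fun i n => by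
    rw [MvPowerSeries.X_pow_eq, MvPowerSeries.order_monomial_of_ne_zero one_ne_zero, Finsupp.degree_single]
  refine lt_of_lt_of_le ?_ MvPowerSeries.le_order_mul
  rw [hX, hX, ← Nat.cast_add, Nat.one_lt_cast]
  omega

/-- S2 FROM THE CLASS KEYS (CHAIN v4.1 (iv), ordered XS twin of `wildUnaryConeSurfaceWon_of_classKeys`):
`(S2iM) → (S2sP) → S2`, where S2iM = `stub_charTwoInseparableReductionWon` and S2sP = `stub_charTwoSeparablePureWon` are the two OPEN
registered class stubs of skeleton v28 (statements verbatim as hypotheses) and S2 = the v20/v22 registered piece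
`stub_charTwoDoublePointSurfaceWon` (statement verbatim as the conclusion).  Derivation = v28's: the inseparable half by modus ponens with the
landed terminal cases `stub_charTwoInseparableTerminalWon`; the separable half through `charTwoSeparableReduction_of_pureWon` and the landed
`stub_charTwoSeparableTerminalWon`; glued by `charTwoDoublePointSurfaceWon_of_monicForms` (case split on `A₁ = 0`). -/
theorem charTwoDoublePointSurfaceWon_of_classKeys
    (hS2iM : ∀ (k : Type) [Field k] [CharP k 2] [IsAlgClosed k],
      (∀ m : ℕ, m < 3 → ∀ g : MvPowerSeries (Fin m) k,
        CobordantGame.IsSingular k g → CobordantGame.Won k m g) →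
      (∀ (A₀ : MvPowerSeries (Fin 2) k), (2 : ℕ∞) < A₀.order →
        ((∃ (r s : ℕ) (U : MvPowerSeries (Fin 2) k), MvPowerSeries.constantCoeff U ≠ 0 ∧ ¬ (2 ∣ r ∧ 2 ∣ s) ∧
            A₀ = MvPowerSeries.X (0 : Fin 2) ^ r * MvPowerSeries.X (1 : Fin 2) ^ s * U) ∨
          (∃ (i : Fin 2) (m : ℕ) (g : MvPowerSeries (Fin 2) k), 0 < m ∧ g.order = 1 ∧
            A₀ = MvPowerSeries.X i ^ (2 * m) * g)) →
        CobordantGame.Won k 3 (MvPowerSeries.X (Fin.last 2) ^ 2 +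
          MvPowerSeries.rename (Fin.succAboveEmb (Fin.last 2)) A₀)) →
      ∀ (A₀ : MvPowerSeries (Fin 2) k), (2 : ℕ∞) < A₀.order →
        CobordantGame.Won k 3 (MvPowerSeries.X (Fin.last 2) ^ 2 +
          MvPowerSeries.rename (Fin.succAboveEmb (Fin.last 2)) A₀))
    (hS2sP : ∀ (k : Type) [Field k] [CharP k 2] [IsAlgClosed k],
      (∀ m : ℕ, m < 3 → ∀ g : MvPowerSeries (Fin m) k,
        CobordantGame.IsSingular k g → CobordantGame.Won k m g) →
      ∀ (A₀ : MvPowerSeries (Fin 2) k) (a b : ℕ), (2 : ℕ∞) < A₀.order → 2 ≤ a + b →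
        CobordantGame.Won k 3 (MvPowerSeries.X (Fin.last 2) ^ 2 +
          (MvPowerSeries.rename (Fin.succAboveEmb (Fin.last 2)) A₀ +
            MvPowerSeries.rename (Fin.succAboveEmb (Fin.last 2)) (MvPowerSeries.X 0 ^ a * MvPowerSeries.X 1 ^ b) *
              MvPowerSeries.X (Fin.last 2)))) :
    ∀ (k : Type) [Field k] [CharP k 2] [IsAlgClosed k],
      (∀ m : ℕ, m < 3 → ∀ g : MvPowerSeries (Fin m) k,
        CobordantGame.IsSingular k g → CobordantGame.Won k m g) →
      ∀ (f : MvPowerSeries (Fin 3) k), CobordantGame.IsSingular k f →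
      (∀ g : MvPowerSeries (Fin 3) k, CobordantGame.IsSingular k g → g.order < f.order →
        CobordantGame.Won k 3 g) →
      f.order = 2 →
      (∃ ℓ : Fin 3 → k, ∀ i j : Fin 3,
        MvPowerSeries.coeff (Finsupp.single i 1 + Finsupp.single j 1) f =
          MvPowerSeries.coeff (Finsupp.single i 1 + Finsupp.single j 1)
            ((∑ l, MvPowerSeries.C (ℓ l) * MvPowerSeries.X l) ^ 2)) →
      CobordantGame.Won k 3 f :=
  charTwoDoublePointSurfaceWon_of_monicForms fun k _ _ _ hlow A₀ A₁ hA₀ hA₁ => by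
    by_cases hA : A₁ = 0
    · subst hA
      have h := hS2iM k hlow (stub_charTwoInseparableTerminalWon k hlow) A₀ hA₀
      simpa only [map_zero, zero_mul, add_zero] using h
    · exact charTwoSeparableReduction_of_pureWon k hlow (hS2sP k hlow) A₀ A₁ hA₀ hA₁ hA

/-- ALL CHAR-2 MONIC DOUBLE POINTS ARE WON FROM THE LEAD'S KEY: if every reduced position of the descent game descends
(`stub_monicDoublePointDescends` of skeleton v22/v28, statement verbatim as the hypothesis), then over every algebraically closed field of
characteristic `2`, given the singular germs in `≤ 2` variables, every monic `y² + A₁ y + A₀` (`ord A₀ ≥ 3`, `ord A₁ ≥ 2`) is won.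
Composition `monicFormsWon_of_charTwoDoublePointSurfaceWon ∘ charTwoDoublePointSurfaceWon_of_reducedFormalRank ∘ formalStep_of_descends`
(p468075, p482941, p485496) — exactly v28's `monicDoublePointsWon_of_formalRankStub` with N4″ unfolded to the Descends key. -/
theorem monicDoublePointsWon_of_descends
    (hdesc : ∀ (k : Type) [Field k] [CharP k 2] [IsAlgClosed k] (A₀ A₁ : MvPowerSeries (Fin 2) k),
      MonicDescent.IsPosition A₀ A₁ → ¬ MonicDescent.IsDoublePlane A₀ A₁ → MonicDescent.Descends A₀ A₁) :
    ∀ (k : Type) [Field k] [CharP k 2] [IsAlgClosed k],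
      (∀ m : ℕ, m < 3 → ∀ g : MvPowerSeries (Fin m) k,
        CobordantGame.IsSingular k g → CobordantGame.Won k m g) →
      ∀ (A₀ A₁ : MvPowerSeries (Fin 2) k), (2 : ℕ∞) < A₀.order → (1 : ℕ∞) < A₁.order →
        CobordantGame.Won k 3 (MvPowerSeries.X (Fin.last 2) ^ 2 +
          (MvPowerSeries.rename (Fin.succAboveEmb (Fin.last 2)) A₀ +
            MvPowerSeries.rename (Fin.succAboveEmb (Fin.last 2)) A₁ * MvPowerSeries.X (Fin.last 2))) :=
  monicFormsWon_of_charTwoDoublePointSurfaceWon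
    (charTwoDoublePointSurfaceWon_of_reducedFormalRank (formalStep_of_descends hdesc))

/-- S2 FROM THE LEAD'S KEY: `stub_monicDoublePointDescends` (verbatim, as hypothesis) ⇒ the v20/v22 registered piece
`stub_charTwoDoublePointSurfaceWon` (verbatim, as conclusion) — `charTwoDoublePointSurfaceWon_of_reducedFormalRank ∘ formalStep_of_descends`. -/
theorem charTwoDoublePointSurfaceWon_of_descends
    (hdesc : ∀ (k : Type) [Field k] [CharP k 2] [IsAlgClosed k] (A₀ A₁ : MvPowerSeries (Fin 2) k),
      MonicDescent.IsPosition A₀ A₁ → ¬ MonicDescent.IsDoublePlane A₀ A₁ → MonicDescent.Descends A₀ A₁) :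
    ∀ (k : Type) [Field k] [CharP k 2] [IsAlgClosed k],
      (∀ m : ℕ, m < 3 → ∀ g : MvPowerSeries (Fin m) k,
        CobordantGame.IsSingular k g → CobordantGame.Won k m g) →
      ∀ (f : MvPowerSeries (Fin 3) k), CobordantGame.IsSingular k f →
      (∀ g : MvPowerSeries (Fin 3) k, CobordantGame.IsSingular k g → g.order < f.order →
        CobordantGame.Won k 3 g) →
      f.order = 2 →
      (∃ ℓ : Fin 3 → k, ∀ i j : Fin 3,
        MvPowerSeries.coeff (Finsupp.single i 1 + Finsupp.single j 1) f =
          MvPowerSeries.coeff (Finsupp.single i 1 + Finsupp.single j 1)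
            ((∑ l, MvPowerSeries.C (ℓ l) * MvPowerSeries.X l) ^ 2)) →
      CobordantGame.Won k 3 f :=
  charTwoDoublePointSurfaceWon_of_reducedFormalRank (formalStep_of_descends hdesc)

/-- S2iM BY THE LEAD'S KEY: `stub_monicDoublePointDescends` (verbatim, as hypothesis) ⇒ the registered class stub S2iM
`stub_charTwoInseparableReductionWon` (statement VERBATIM as the conclusion; its terminal-case hypothesis is not used).  Once the key is a tree
theorem, `theorem stub_charTwoInseparableReductionWon := charTwoInseparableReduction_of_descends stub_monicDoublePointDescends` closes S2iM by name. -/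
theorem charTwoInseparableReduction_of_descends
    (hdesc : ∀ (k : Type) [Field k] [CharP k 2] [IsAlgClosed k] (A₀ A₁ : MvPowerSeries (Fin 2) k),
      MonicDescent.IsPosition A₀ A₁ → ¬ MonicDescent.IsDoublePlane A₀ A₁ → MonicDescent.Descends A₀ A₁) :
    ∀ (k : Type) [Field k] [CharP k 2] [IsAlgClosed k],
      (∀ m : ℕ, m < 3 → ∀ g : MvPowerSeries (Fin m) k,
        CobordantGame.IsSingular k g → CobordantGame.Won k m g) →
      (∀ (A₀ : MvPowerSeries (Fin 2) k), (2 : ℕ∞) < A₀.order →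
        ((∃ (r s : ℕ) (U : MvPowerSeries (Fin 2) k), MvPowerSeries.constantCoeff U ≠ 0 ∧ ¬ (2 ∣ r ∧ 2 ∣ s) ∧
            A₀ = MvPowerSeries.X (0 : Fin 2) ^ r * MvPowerSeries.X (1 : Fin 2) ^ s * U) ∨
          (∃ (i : Fin 2) (m : ℕ) (g : MvPowerSeries (Fin 2) k), 0 < m ∧ g.order = 1 ∧
            A₀ = MvPowerSeries.X i ^ (2 * m) * g)) →
        CobordantGame.Won k 3 (MvPowerSeries.X (Fin.last 2) ^ 2 +
          MvPowerSeries.rename (Fin.succAboveEmb (Fin.last 2)) A₀)) →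
      ∀ (A₀ : MvPowerSeries (Fin 2) k), (2 : ℕ∞) < A₀.order →
        CobordantGame.Won k 3 (MvPowerSeries.X (Fin.last 2) ^ 2 +
          MvPowerSeries.rename (Fin.succAboveEmb (Fin.last 2)) A₀) := by
  intro k _ _ _ hlow _hterm A₀ hA₀
  have h := monicDoublePointsWon_of_descends hdesc k hlow A₀ 0 hA₀ (by simp)
  simpa only [map_zero, zero_mul, add_zero] using h

/-- S2sP BY THE LEAD'S KEY: `stub_monicDoublePointDescends` (verbatim, as hypothesis) ⇒ the registered class stub S2sP
`stub_charTwoSeparablePureWon` (statement VERBATIM as the conclusion): the pure separable double point `y² + x₀^a x₁^b·y + A₀`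
(`a + b ≥ 2`, `ord A₀ ≥ 3`) is the monic double point with `A₁ = x₀^a x₁^b`, `ord A₁ = a + b ≥ 2`.  Once the key is a tree theorem,
`theorem stub_charTwoSeparablePureWon := charTwoSeparablePure_of_descends stub_monicDoublePointDescends` closes S2sP by name. -/
theorem charTwoSeparablePure_of_descends
    (hdesc : ∀ (k : Type) [Field k] [CharP k 2] [IsAlgClosed k] (A₀ A₁ : MvPowerSeries (Fin 2) k),
      MonicDescent.IsPosition A₀ A₁ → ¬ MonicDescent.IsDoublePlane A₀ A₁ → MonicDescent.Descends A₀ A₁) :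
    ∀ (k : Type) [Field k] [CharP k 2] [IsAlgClosed k],
      (∀ m : ℕ, m < 3 → ∀ g : MvPowerSeries (Fin m) k,
        CobordantGame.IsSingular k g → CobordantGame.Won k m g) →
      ∀ (A₀ : MvPowerSeries (Fin 2) k) (a b : ℕ), (2 : ℕ∞) < A₀.order → 2 ≤ a + b →
        CobordantGame.Won k 3 (MvPowerSeries.X (Fin.last 2) ^ 2 +
          (MvPowerSeries.rename (Fin.succAboveEmb (Fin.last 2)) A₀ +
            MvPowerSeries.rename (Fin.succAboveEmb (Fin.last 2)) (MvPowerSeries.X 0 ^ a * MvPowerSeries.X 1 ^ b) *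
              MvPowerSeries.X (Fin.last 2))) :=
  fun k _ _ _ hlow A₀ a b hA₀ hab =>
    monicDoublePointsWon_of_descends hdesc k hlow A₀ (MvPowerSeries.X 0 ^ a * MvPowerSeries.X 1 ^ b) hA₀
      (one_lt_order_X_pow_mul_X_pow hab)

/-- S2sM BY THE LEAD'S KEY: `stub_monicDoublePointDescends` (verbatim, as hypothesis) ⇒ the v24–v26 registered class stub S2sM
`stub_charTwoSeparableReductionWon` (statement VERBATIM; in v27/v28 it is already a theorem from S2sP — this is the key-direct form, the
terminal-case hypothesis and `A₁ ≠ 0` unused). -/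
theorem charTwoSeparableReduction_of_descends
    (hdesc : ∀ (k : Type) [Field k] [CharP k 2] [IsAlgClosed k] (A₀ A₁ : MvPowerSeries (Fin 2) k),
      MonicDescent.IsPosition A₀ A₁ → ¬ MonicDescent.IsDoublePlane A₀ A₁ → MonicDescent.Descends A₀ A₁) :
    ∀ (k : Type) [Field k] [CharP k 2] [IsAlgClosed k],
      (∀ m : ℕ, m < 3 → ∀ g : MvPowerSeries (Fin m) k,
        CobordantGame.IsSingular k g → CobordantGame.Won k m g) →
      (∀ (A₀ A₁ : MvPowerSeries (Fin 2) k), (2 : ℕ∞) < A₀.order → (1 : ℕ∞) < A₁.order → A₁ ≠ 0 →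
        ((∃ (r s : ℕ) (U B : MvPowerSeries (Fin 2) k), MvPowerSeries.constantCoeff U ≠ 0 ∧ ¬ (2 ∣ r ∧ 2 ∣ s) ∧
            A₀ = MvPowerSeries.X (0 : Fin 2) ^ r * MvPowerSeries.X (1 : Fin 2) ^ s * U ∧
            A₁ = MvPowerSeries.X (0 : Fin 2) ^ (r / 2) * MvPowerSeries.X (1 : Fin 2) ^ (s / 2) * B) ∨
          (∃ (r s : ℕ) (V W : MvPowerSeries (Fin 2) k), MvPowerSeries.constantCoeff V ≠ 0 ∧
            A₁ = MvPowerSeries.X (0 : Fin 2) ^ r * MvPowerSeries.X (1 : Fin 2) ^ s * V ∧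
            A₀ = MvPowerSeries.X (0 : Fin 2) ^ (2 * r) * MvPowerSeries.X (1 : Fin 2) ^ (2 * s) * W) ∨
          (∃ (i : Fin 2) (m : ℕ) (g B : MvPowerSeries (Fin 2) k), 0 < m ∧ g.order = 1 ∧
            A₀ = MvPowerSeries.X i ^ (2 * m) * g ∧ A₁ = MvPowerSeries.X i ^ m * B)) →
        CobordantGame.Won k 3 (MvPowerSeries.X (Fin.last 2) ^ 2 +
          (MvPowerSeries.rename (Fin.succAboveEmb (Fin.last 2)) A₀ +
            MvPowerSeries.rename (Fin.succAboveEmb (Fin.last 2)) A₁ * MvPowerSeries.X (Fin.last 2)))) →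
      ∀ (A₀ A₁ : MvPowerSeries (Fin 2) k), (2 : ℕ∞) < A₀.order → (1 : ℕ∞) < A₁.order → A₁ ≠ 0 →
        CobordantGame.Won k 3 (MvPowerSeries.X (Fin.last 2) ^ 2 +
          (MvPowerSeries.rename (Fin.succAboveEmb (Fin.last 2)) A₀ +
            MvPowerSeries.rename (Fin.succAboveEmb (Fin.last 2)) A₁ * MvPowerSeries.X (Fin.last 2))) :=
  fun k _ _ _ hlow _hterm A₀ A₁ hA₀ hA₁ _hne => monicDoublePointsWon_of_descends hdesc k hlow A₀ A₁ hA₀ hA₁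

end Summit.ResolutionOfSingularities.ResolutionOfSingularities.Theorems
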